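import Literature.Probability.LatticeModels.CoarseCellMixingCounting
import Literature.Probability.LatticeModels.CoarseCellMixingDLR
import HarnessLib

/-!
# Coarse-cell mixing with defects: the chain rule under an admissibility region

Companion ("theorems only") file of `CoarseCellMixingDefectsChain.lean`. The chain rule with
defects there (`multiCell_influence_good`) asks the single-cell influence bound for boundary
conditions agreeing within a UNIFORM radius `ρ` of the cell and good within `ρ'`. The expansion
around Peierls-rare bad clusters runs the chain rule over the ring of a resampled cluster, whose
cells sit at different distances from the disagreement region, each with its own influence bound
at its own remaining radius. The natural bookkeeping is a fixed SOURCE REGION `F` of cells: two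
boundary conditions are admissible for a cell-union volume `Λ` if on every frozen site whose cell
is not in `F` they agree and are good (`AdmRegion`). Freezing a good cell at a common value keeps
admissibility, so the induction over the cells of the observable goes through verbatim, with a
CELL-DEPENDENT single-cell bound `δ y`:

* `AdmRegion cell good F Λ ζ ζ'` — the admissibility predicate;
* `AdmRegion.symm`, `AdmRegion.mono` (in `F`), `admRegion_of_freeze` (freezing the cell `y` at the
  values of a `γ_Λ(·|ζ)`-typical configuration good at `y`);
* `multiCell_influence_adm` — if for every cell-union volume and every `F`-admissible pair the
  influence on `[0,1]`-valued observables of the cell `y` is `≤ δ y`, then for a `[0,1]`-valued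
  observable of the `Λ`-cells `Y` vanishing whenever a cell of `Y` is bad, and an `F`-admissible
  pair, the influence is `≤ Σ_{y ∈ Y} δ y`; `multiCell_influence_adm_of_abs_le` — sup norm `≤ λ`,
  factor `2λ`.

## References

* R. L. Dobrushin, S. B. Shlosman, *Constructive criterion for the uniqueness of Gibbs field*
  (1985), §2; H.-O. Georgii, *Gibbs Measures and Phase Transitions* (2011), §8.2.
* J. van den Berg, C. Maes, *Disagreement percolation in the study of Markov fields*,
  Ann. Probab. 22 (1994), §2.
-/

noncomputable section

open _root_.MeasureTheory
open scoped ENNReal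

namespace Literature.Probability.LatticeModels

variable {d : ℕ} {μc : Fin d → ℕ} {V S : Type*} [MeasurableSpace S]

/-! ### Admissible boundary pairs relative to a source region -/

/-- **Admissibility of a boundary pair relative to the source region `F`**: on every site outside the
volume `Λ` whose cell is not in `F`, the two boundary conditions agree and are good. (Inside the
cells of `F` — the sources — nothing is required.) [folklore] -/
def AdmRegion (cell : V → CoarseIdx μc) (good : CoarseIdx μc → Set (V → S))
    (F : Finset (CoarseIdx μc)) (Λ : Finset V) (ζ ζ' : V → S) : Prop :=
  ∀ v, v ∉ Λ → cell v ∉ F → ζ v = ζ' v ∧ ζ ∈ good (cell v) ∧ ζ' ∈ good (cell v)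

omit [MeasurableSpace S] in
/-- Admissibility is symmetric in the pair. [folklore] -/
theorem AdmRegion.symm {cell : V → CoarseIdx μc} {good : CoarseIdx μc → Set (V → S)}
    {F : Finset (CoarseIdx μc)} {Λ : Finset V} {ζ ζ' : V → S}
    (h : AdmRegion cell good F Λ ζ ζ') : AdmRegion cell good F Λ ζ' ζ := fun v hv hF =>
  ⟨(h v hv hF).1.symm, (h v hv hF).2.2, (h v hv hF).2.1⟩

omit [MeasurableSpace S] in
/-- Admissibility is monotone in the source region. [folklore] -/
theorem AdmRegion.mono {cell : V → CoarseIdx μc} {good : CoarseIdx μc → Set (V → S)}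
    {F F' : Finset (CoarseIdx μc)} (hFF' : F ⊆ F') {Λ : Finset V} {ζ ζ' : V → S}
    (h : AdmRegion cell good F Λ ζ ζ') : AdmRegion cell good F' Λ ζ ζ' := fun v hv hF =>
  h v hv fun hvF => hF (hFF' hvF)

omit [MeasurableSpace S] in
/-- The diagonal pair `(ζ, ζ)` is admissible as soon as `ζ` is good on the frozen cells off `F`.
[folklore] -/
theorem admRegion_self {cell : V → CoarseIdx μc} {good : CoarseIdx μc → Set (V → S)}
    {F : Finset (CoarseIdx μc)} {Λ : Finset V} {ζ : V → S}
    (h : ∀ v, v ∉ Λ → cell v ∉ F → ζ ∈ good (cell v)) : AdmRegion cell good F Λ ζ ζ :=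
  fun v hv hF => ⟨rfl, h v hv hF, h v hv hF⟩

/-! ### The chain rule under an admissibility region -/

/-- **Multi-cell influence from single-cell influence, with defects, relative to a source region**
(the chain rule of the expansion around bad clusters): suppose that for EVERY cell-union volume
`Λ`, every cell `x`, and every `F`-admissible boundary pair, the `γ_Λ`-expectations of
`[0,1]`-valued observables of `x` differ by at most `δ x`. Then for a `[0,1]`-valued observable
`H` of cells `Y` all of whose sites lie in `Λ`, VANISHING whenever some cell of `Y` is bad, and an
`F`-admissible pair, the expectations differ by at most `Σ_{y ∈ Y} δ y`. Induction on `Y`: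
condition on one cell `y` (consistency), compare through the hybrid single-cell observable
`σ ↦ γ_{Λ∖y}(H | σ on Λ, ζ' off Λ)`; the frozen cell is either good — then the new pair is again
`F`-admissible in `Λ ∖ y` and the induction hypothesis applies — or bad, and then both inner
expectations vanish. [folklore] -/
theorem multiCell_influence_adm [Fintype V] {cell : V → CoarseIdx μc}
    {γ : Specification V S} (hγ : IsSpecification γ) {good : CoarseIdx μc → Set (V → S)}
    (hgl : ∀ (c : CoarseIdx μc) (σ τ : V → S), (∀ v, cell v = c → σ v = τ v) →
      (σ ∈ good c ↔ τ ∈ good c))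
    (F : Finset (CoarseIdx μc)) {δ : CoarseIdx μc → ℝ} (hδ : ∀ x, 0 ≤ δ x)
    (hR : ∀ (Λ : Finset V), (∀ v w, cell v = cell w → v ∈ Λ → w ∈ Λ) →
      ∀ (x : CoarseIdx μc) (g : (V → S) → ℝ), Measurable g → (∀ σ, 0 ≤ g σ ∧ g σ ≤ 1) →
      DependsOn g {v | cell v = x} →
      ∀ ζ ζ' : V → S, AdmRegion cell good F Λ ζ ζ' →
        |∫ σ, g σ ∂(γ Λ ζ) - ∫ σ, g σ ∂(γ Λ ζ')| ≤ δ x)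
    (Y : Finset (CoarseIdx μc)) :
    ∀ (Λ : Finset V), (∀ v w, cell v = cell w → v ∈ Λ → w ∈ Λ) →
      (∀ y ∈ Y, ∀ v, cell v = y → v ∈ Λ) →
      ∀ (H : (V → S) → ℝ), Measurable H → (∀ σ, 0 ≤ H σ ∧ H σ ≤ 1) →
      DependsOn H {v | cell v ∈ Y} → (∀ σ, (∃ y ∈ Y, σ ∉ good y) → H σ = 0) →
      ∀ ζ ζ' : V → S, AdmRegion cell good F Λ ζ ζ' →
        |∫ σ, H σ ∂(γ Λ ζ) - ∫ σ, H σ ∂(γ Λ ζ')| ≤ ∑ y ∈ Y, δ y := by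
  classical
  refine Finset.induction_on Y ?_ ?_
  · intro Λ hΛ _ H hHm hH01 hHdep hH0 ζ ζ' _
    have hconst : ∀ σ τ, H σ = H τ := fun σ τ =>
      hHdep fun v hv => absurd hv (Finset.notMem_empty _)
    haveI := hγ.isProbability Λ ζ
    haveI := hγ.isProbability Λ ζ'
    have hH : H = fun _ => H ζ := funext fun σ => hconst σ ζ
    rw [hH]
    simp
  · intro y Y' hy IH Λ hΛ hYΛ H hHm hH01 hHdep hH0 ζ ζ' hadm
    have hyΛ : ∀ v, cell v = y → v ∈ Λ := hYΛ y (Finset.mem_insert_self y Y')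
    have hY'Λ : ∀ y' ∈ Y', ∀ v, cell v = y' → v ∈ Λ := fun y' hy' =>
      hYΛ y' (Finset.mem_insert_of_mem hy')
    -- remove the cell `y` from the volume
    set Λ₁ : Finset V := Λ.filter fun v => cell v ≠ y with hΛ₁
    have hΛ₁Λ : Λ₁ ⊆ Λ := Finset.filter_subset _ _
    have hΛ₁union : ∀ v w, cell v = cell w → v ∈ Λ₁ → w ∈ Λ₁ := fun v w hvw hv => by
      rw [hΛ₁, Finset.mem_filter] at hv ⊢
      exact ⟨hΛ v w hvw hv.1, hvw ▸ hv.2⟩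
    have hY'Λ₁ : ∀ y' ∈ Y', ∀ v, cell v = y' → v ∈ Λ₁ := fun y' hy' v hv => by
      rw [hΛ₁, Finset.mem_filter]
      exact ⟨hY'Λ y' hy' v hv, fun h => hy (h ▸ hv ▸ hy')⟩
    have hH1 : ∀ σ, |H σ| ≤ 1 := fun σ => by rw [abs_of_nonneg (hH01 σ).1]; exact (hH01 σ).2
    have hcons : ∀ η, ∫ σ, H σ ∂(γ Λ η) = ∫ σ, (∫ τ, H τ ∂(γ Λ₁ σ)) ∂(γ Λ η) := fun η =>
      (kernel_integral_integral_eq_of_subset hγ hΛ₁Λ η hHm hH1).symm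
    -- an inner expectation vanishes as soon as the (frozen) cell `y` is bad
    have hvan : ∀ η : V → S, η ∉ good y → ∫ τ, H τ ∂(γ Λ₁ η) = 0 := by
      intro η hη
      have h : ∀ᵐ τ ∂(γ Λ₁ η), H τ = 0 := by
        filter_upwards [hγ.proper Λ₁ η] with τ hτ
        refine hH0 τ ⟨y, Finset.mem_insert_self y Y', fun hτy => hη ?_⟩
        refine (hgl y τ η fun v hv => hτ v fun hvΛ₁ => ?_).1 hτy
        exact (Finset.mem_filter.1 hvΛ₁).2 hv
      rw [integral_congr_ae h, integral_zero]
    -- the hybrid glue: `σ` on `Λ`, `ζ'` off `Λ`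
    let J : (V → S) → (V → S) := fun σ v => if v ∈ Λ then σ v else ζ' v
    have hJm : Measurable J := by
      refine measurable_pi_iff.2 fun v => ?_
      by_cases hv : v ∈ Λ
      · simp only [J, hv, if_true]
        exact measurable_pi_apply v
      · simp only [J, hv, if_false]
        exact measurable_const
    have hJy : ∀ σ : V → S, ∀ v, cell v = y → J σ v = σ v := fun σ v hvy => by
      simp only [J, hyΛ v hvy, if_true]
    set G : (V → S) → ℝ := fun σ => ∫ τ, H τ ∂(γ Λ₁ (J σ)) with hG
    have hGm : Measurable G := (DobrushinShlosman.measurable_windowAvg' hγ Λ₁ hHm).comp hJm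
    have hG01 : ∀ σ, 0 ≤ G σ ∧ G σ ≤ 1 := fun σ => by
      haveI := hγ.isProbability Λ₁ (J σ)
      exact integral_mem_unitInterval hHm hH01
    have hG1 : ∀ σ, |G σ| ≤ 1 := fun σ => by rw [abs_of_nonneg (hG01 σ).1]; exact (hG01 σ).2
    have hGdep : DependsOn G {v | cell v = y} := by
      intro σ σ' hσσ'
      simp only [hG]
      rw [DobrushinShlosman.spec_apply_congr hγ Λ₁ (ω := J σ) (η := J σ') ?_]
      intro v hv
      by_cases hvΛ : v ∈ Λ
      · have hvy : cell v = y := by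
          by_contra h
          exact hv (Finset.mem_filter.2 ⟨hvΛ, h⟩)
        simp only [J, hvΛ, if_true]
        exact hσσ' v hvy
      · simp only [J, hvΛ, if_false]
    -- (ii) the hybrid is a single-cell observable of `y`
    have hii : |∫ σ, G σ ∂(γ Λ ζ) - ∫ σ, G σ ∂(γ Λ ζ')| ≤ δ y := hR Λ hΛ y G hGm hG01 hGdep ζ ζ' hadm
    -- under `ζ'` the hybrid is the honest inner kernel
    have hG' : ∫ σ, G σ ∂(γ Λ ζ') = ∫ σ, (∫ τ, H τ ∂(γ Λ₁ σ)) ∂(γ Λ ζ') := by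
      refine integral_congr_ae ?_
      filter_upwards [hγ.proper Λ ζ'] with σ hσ
      simp only [hG]
      have hJσ : J σ = σ := funext fun v => by
        by_cases hv : v ∈ Λ
        · simp only [J, hv, if_true]
        · simp only [J, hv, if_false]
          exact (hσ v hv).symm
      rw [hJσ]
    -- (i) under `ζ` the hybrid differs from the honest inner kernel by the induction hypothesis
    have hi : ∀ᵐ σ ∂(γ Λ ζ), |(∫ τ, H τ ∂(γ Λ₁ σ)) - G σ| ≤ ∑ y' ∈ Y', δ y' := by
      filter_upwards [hγ.proper Λ ζ] with σ hσ
      by_cases hσy : σ ∈ good y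
      · -- the frozen cell `y` is good: freeze it and apply the induction hypothesis
        let Hs : (V → S) → ℝ := fun ω => H (fun v => if cell v = y then σ v else ω v)
        have hfrz : Measurable fun ω : V → S => (fun v => if cell v = y then σ v else ω v) := by
          refine measurable_pi_iff.2 fun v => ?_
          by_cases h : cell v = y
          · simp only [h, if_true]
            exact measurable_const
          · simp only [h, if_false]
            exact measurable_pi_apply v
        have hHsm : Measurable Hs := hHm.comp hfrz
        have hHs01 : ∀ ω, 0 ≤ Hs ω ∧ Hs ω ≤ 1 := fun ω => hH01 _
        have hHsdep : DependsOn Hs {v | cell v ∈ Y'} := by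
          intro ω ω' hωω'
          simp only [Hs]
          apply hHdep
          intro v hv
          by_cases hvy : cell v = y
          · simp only [hvy, if_true]
          · simp only [hvy, if_false]
            have hv' : cell v ∈ insert y Y' := hv
            rcases Finset.mem_insert.1 hv' with h | h
            · exact absurd h hvy
            · exact hωω' v h
        have hHs0 : ∀ ω, (∃ y' ∈ Y', ω ∉ good y') → Hs ω = 0 := by
          rintro ω ⟨y', hy', hωy'⟩
          simp only [Hs]
          refine hH0 _ ⟨y', Finset.mem_insert_of_mem hy', fun hgood' => hωy' ?_⟩
          have hy'y : y' ≠ y := fun h => hy (h ▸ hy')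
          refine (hgl y' _ ω fun v hv => ?_).1 hgood'
          have hvy : cell v ≠ y := fun h => hy'y (hv.symm.trans h)
          simp only [hvy, if_false]
        have hfreeze : ∀ η : V → S, (∀ v, cell v = y → η v = σ v) →
            ∫ τ, H τ ∂(γ Λ₁ η) = ∫ τ, Hs τ ∂(γ Λ₁ η) := by
          intro η hη
          refine integral_congr_ae ?_
          filter_upwards [hγ.proper Λ₁ η] with τ hτ
          simp only [Hs]
          congr 1
          funext v
          by_cases hvy : cell v = y
          · simp only [hvy, if_true]
            have hvΛ₁ : v ∉ Λ₁ := fun h => (Finset.mem_filter.1 h).2 hvy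
            rw [hτ v hvΛ₁, hη v hvy]
          · simp only [hvy, if_false]
        have e1 : ∫ τ, H τ ∂(γ Λ₁ σ) = ∫ τ, Hs τ ∂(γ Λ₁ σ) := hfreeze σ fun v _ => rfl
        have e2 : G σ = ∫ τ, Hs τ ∂(γ Λ₁ (J σ)) := by
          simp only [hG]
          exact hfreeze (J σ) (hJy σ)
        rw [e1, e2]
        refine IH Λ₁ hΛ₁union hY'Λ₁ Hs hHsm hHs01 hHsdep hHs0 σ (J σ) ?_
        -- the new pair is `F`-admissible for `Λ₁`
        intro v hv hvF
        by_cases hvΛ : v ∈ Λ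
        · -- a newly frozen site: its cell is `y`, good for `σ` and for `J σ = σ` there
          have hvy : cell v = y := by
            by_contra h
            exact hv (Finset.mem_filter.2 ⟨hvΛ, h⟩)
          have eσ : σ ∈ good (cell v) ↔ σ ∈ good y := by rw [hvy]
          have eJ : J σ ∈ good (cell v) ↔ σ ∈ good (cell v) :=
            hgl (cell v) (J σ) σ fun w hw => hJy σ w (hw.trans hvy)
          exact ⟨by simp only [J, hvΛ, if_true], eσ.2 hσy, eJ.2 (eσ.2 hσy)⟩
        · -- an originally frozen site off the sources: agreement and goodness of `ζ`, `ζ'`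
          have hcell : ∀ w, cell w = cell v → w ∉ Λ := fun w hw hwΛ =>
            hvΛ (hΛ w v hw hwΛ)
          obtain ⟨hζζ', hζg, hζ'g⟩ := hadm v hvΛ hvF
          have eσ : σ ∈ good (cell v) ↔ ζ ∈ good (cell v) :=
            hgl (cell v) σ ζ fun w hw => hσ w (hcell w hw)
          have eJ : J σ ∈ good (cell v) ↔ ζ' ∈ good (cell v) :=
            hgl (cell v) (J σ) ζ' fun w hw => by simp only [J, hcell w hw, if_false]
          refine ⟨?_, eσ.2 hζg, eJ.2 hζ'g⟩
          simp only [J, hvΛ, if_false]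
          rw [hσ v hvΛ, hζζ']
      · -- the frozen cell `y` is bad: both inner expectations vanish
        have h1 : ∫ τ, H τ ∂(γ Λ₁ σ) = 0 := hvan σ hσy
        have h2 : G σ = 0 := by
          simp only [hG]
          exact hvan (J σ) fun hJ => hσy ((hgl y (J σ) σ (hJy σ)).1 hJ)
        rw [h1, h2, sub_zero, abs_zero]
        exact Finset.sum_nonneg fun y' _ => hδ y'
    -- assemble
    haveI := hγ.isProbability Λ ζ
    haveI := hγ.isProbability Λ ζ'
    have hKi : Integrable (fun σ => ∫ τ, H τ ∂(γ Λ₁ σ)) (γ Λ ζ) :=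
      DobrushinMetric.integrable_of_abs_le' (DobrushinShlosman.measurable_windowAvg' hγ Λ₁ hHm)
        (DobrushinShlosman.abs_windowAvg_le' hγ Λ₁ hH1)
    have hGi : Integrable G (γ Λ ζ) := DobrushinMetric.integrable_of_abs_le' hGm hG1
    have hdiff : |∫ σ, (∫ τ, H τ ∂(γ Λ₁ σ)) ∂(γ Λ ζ) - ∫ σ, G σ ∂(γ Λ ζ)| ≤ ∑ y' ∈ Y', δ y' := by
      rw [← integral_sub hKi hGi]
      have h := norm_integral_le_of_norm_le_const (μ := γ Λ ζ) (C := ∑ y' ∈ Y', δ y')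
        (f := fun σ => (∫ τ, H τ ∂(γ Λ₁ σ)) - G σ)
        (hi.mono fun σ hσ => by rw [Real.norm_eq_abs]; exact hσ)
      simpa using h
    calc |∫ σ, H σ ∂(γ Λ ζ) - ∫ σ, H σ ∂(γ Λ ζ')|
        = |∫ σ, (∫ τ, H τ ∂(γ Λ₁ σ)) ∂(γ Λ ζ) - ∫ σ, G σ ∂(γ Λ ζ')| := by
          rw [hcons ζ, hcons ζ', hG']
      _ ≤ |∫ σ, (∫ τ, H τ ∂(γ Λ₁ σ)) ∂(γ Λ ζ) - ∫ σ, G σ ∂(γ Λ ζ)| +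
            |∫ σ, G σ ∂(γ Λ ζ) - ∫ σ, G σ ∂(γ Λ ζ')| := abs_sub_le _ _ _
      _ ≤ (∑ y' ∈ Y', δ y') + δ y := add_le_add hdiff hii
      _ = ∑ y' ∈ insert y Y', δ y' := by
          rw [Finset.sum_insert hy]
          ring

/-- **Chain rule under an admissibility region, bounded observables**: under the hypotheses of
`multiCell_influence_adm`, an observable of the `Λ`-cells `Y` of sup norm `≤ λ` vanishing whenever
some cell of `Y` is bad has influence `≤ 2 λ Σ_{y ∈ Y} δ y` for every `F`-admissible pair
(positive and negative parts). [folklore] -/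
theorem multiCell_influence_adm_of_abs_le [Fintype V] {cell : V → CoarseIdx μc}
    {γ : Specification V S} (hγ : IsSpecification γ) {good : CoarseIdx μc → Set (V → S)}
    (hgl : ∀ (c : CoarseIdx μc) (σ τ : V → S), (∀ v, cell v = c → σ v = τ v) →
      (σ ∈ good c ↔ τ ∈ good c))
    (F : Finset (CoarseIdx μc)) {δ : CoarseIdx μc → ℝ} (hδ : ∀ x, 0 ≤ δ x)
    (hR : ∀ (Λ : Finset V), (∀ v w, cell v = cell w → v ∈ Λ → w ∈ Λ) →
      ∀ (x : CoarseIdx μc) (g : (V → S) → ℝ), Measurable g → (∀ σ, 0 ≤ g σ ∧ g σ ≤ 1) →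
      DependsOn g {v | cell v = x} →
      ∀ ζ ζ' : V → S, AdmRegion cell good F Λ ζ ζ' →
        |∫ σ, g σ ∂(γ Λ ζ) - ∫ σ, g σ ∂(γ Λ ζ')| ≤ δ x)
    (Y : Finset (CoarseIdx μc)) (Λ : Finset V) (hΛ : ∀ v w, cell v = cell w → v ∈ Λ → w ∈ Λ)
    (hYΛ : ∀ y ∈ Y, ∀ v, cell v = y → v ∈ Λ)
    (H : (V → S) → ℝ) (hHm : Measurable H) {lam : ℝ} (hHb : ∀ σ, |H σ| ≤ lam)
    (hHdep : DependsOn H {v | cell v ∈ Y}) (hH0 : ∀ σ, (∃ y ∈ Y, σ ∉ good y) → H σ = 0)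
    (ζ ζ' : V → S) (hadm : AdmRegion cell good F Λ ζ ζ') :
    |∫ σ, H σ ∂(γ Λ ζ) - ∫ σ, H σ ∂(γ Λ ζ')| ≤ 2 * lam * ∑ y ∈ Y, δ y := by
  haveI := hγ.isProbability Λ ζ
  haveI := hγ.isProbability Λ ζ'
  have hlam : 0 ≤ lam := (abs_nonneg _).trans (hHb ζ)
  have hsum : 0 ≤ ∑ y ∈ Y, δ y := Finset.sum_nonneg fun y _ => hδ y
  rcases hlam.eq_or_lt with hlam0 | hlampos
  · have hH0' : ∀ σ, H σ = 0 := fun σ => abs_nonpos_iff.1 (hlam0 ▸ hHb σ)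
    simp only [hH0', integral_zero, sub_self, abs_zero]
    rw [← hlam0]
    positivity
  · set P : (V → S) → ℝ := fun σ => max (H σ) 0 / lam with hP
    set N : (V → S) → ℝ := fun σ => max (-H σ) 0 / lam with hN
    have hPm : Measurable P := (hHm.max measurable_const).div_const lam
    have hNm : Measurable N := (hHm.neg.max measurable_const).div_const lam
    have hP01 : ∀ σ, 0 ≤ P σ ∧ P σ ≤ 1 := fun σ => by
      have h := (abs_le.1 (hHb σ)).2
      refine ⟨div_nonneg (le_max_right _ _) hlampos.le, ?_⟩
      rw [hP, div_le_one hlampos]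
      exact max_le h hlampos.le
    have hN01 : ∀ σ, 0 ≤ N σ ∧ N σ ≤ 1 := fun σ => by
      have h := (abs_le.1 (hHb σ)).1
      refine ⟨div_nonneg (le_max_right _ _) hlampos.le, ?_⟩
      rw [hN, div_le_one hlampos]
      exact max_le (by linarith) hlampos.le
    have hPdep : DependsOn P {v | cell v ∈ Y} := fun σ τ h => by simp only [hP, hHdep h]
    have hNdep : DependsOn N {v | cell v ∈ Y} := fun σ τ h => by simp only [hN, hHdep h]
    have hP0 : ∀ σ, (∃ y ∈ Y, σ ∉ good y) → P σ = 0 := fun σ hσ => by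
      simp only [hP, hH0 σ hσ, max_self, zero_div]
    have hN0 : ∀ σ, (∃ y ∈ Y, σ ∉ good y) → N σ = 0 := fun σ hσ => by
      simp only [hN, hH0 σ hσ, neg_zero, max_self, zero_div]
    have hΨPN : ∀ σ, H σ = lam * (P σ - N σ) := fun σ => by
      simp only [hP, hN]
      rw [← sub_div, mul_div_cancel₀ _ hlampos.ne']
      rcases le_total 0 (H σ) with h | h
      · rw [max_eq_left h, max_eq_right (by linarith)]; ring
      · rw [max_eq_right h, max_eq_left (by linarith)]; ring
    have hPi : ∀ η, Integrable P (γ Λ η) := fun η => by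
      haveI := hγ.isProbability Λ η
      exact DobrushinMetric.integrable_of_abs_le' hPm (M := 1) fun σ => by
        rw [abs_of_nonneg (hP01 σ).1]; exact (hP01 σ).2
    have hNi : ∀ η, Integrable N (γ Λ η) := fun η => by
      haveI := hγ.isProbability Λ η
      exact DobrushinMetric.integrable_of_abs_le' hNm (M := 1) fun σ => by
        rw [abs_of_nonneg (hN01 σ).1]; exact (hN01 σ).2
    have hint : ∀ η, ∫ σ, H σ ∂(γ Λ η) = lam * (∫ σ, P σ ∂(γ Λ η) - ∫ σ, N σ ∂(γ Λ η)) := by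
      intro η
      simp_rw [hΨPN]
      rw [integral_const_mul, integral_sub (hPi η) (hNi η)]
    have hPb := multiCell_influence_adm hγ hgl F hδ hR Y Λ hΛ hYΛ P hPm hP01 hPdep hP0 ζ ζ' hadm
    have hNb := multiCell_influence_adm hγ hgl F hδ hR Y Λ hΛ hYΛ N hNm hN01 hNdep hN0 ζ ζ' hadm
    rw [hint ζ, hint ζ', ← mul_sub, abs_mul, abs_of_pos hlampos]
    have e : (∫ σ, P σ ∂(γ Λ ζ) - ∫ σ, N σ ∂(γ Λ ζ)) - (∫ σ, P σ ∂(γ Λ ζ') - ∫ σ, N σ ∂(γ Λ ζ')) =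
        (∫ σ, P σ ∂(γ Λ ζ) - ∫ σ, P σ ∂(γ Λ ζ')) - (∫ σ, N σ ∂(γ Λ ζ) - ∫ σ, N σ ∂(γ Λ ζ')) := by
      ring
    rw [e]
    calc lam * |(∫ σ, P σ ∂(γ Λ ζ) - ∫ σ, P σ ∂(γ Λ ζ')) -
          (∫ σ, N σ ∂(γ Λ ζ) - ∫ σ, N σ ∂(γ Λ ζ'))|
        ≤ lam * ((∑ y ∈ Y, δ y) + ∑ y ∈ Y, δ y) :=
          mul_le_mul_of_nonneg_left ((abs_sub _ _).trans (add_le_add hPb hNb)) hlampos.le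
      _ = 2 * lam * ∑ y ∈ Y, δ y := by ring

end Literature.Probability.LatticeModels
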